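import Literature.NumberTheory.EllipticCurves.PlusMinusPAdicLFunction
import Literature.NumberTheory.EllipticCurves.PAdicLFunctionDistributionHoldsProofs
import Literature.NumberTheory.EllipticCurves.PAdicLFunctionNeZeroProofs
import Literature.NumberTheory.EllipticCurves.PAdicLFunctionProofs
import Literature.NumberTheory.EllipticCurves.LeadingTermPPartProofs
import HarnessLib

/-!
# The constant terms of Pollack's plus/minus `p`-adic `L`-functions:
# `L⁻(0) = 2·[0]⁺_f`, `L⁺(0) = (p − 1)·[0]⁺_f` (Kobayashi 2003, (3.6)) — PROVED from the tree's
# Mazur–Tate congruences (cell `b2b-bsdres`, supersingular family, prover A = unit `b2b-bsdres-x10b`, gen 4)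

HONEST FRAMING (run/shared/lean/b2b/bsd-rank1-residual/, verbatim in every file): the goal of the
cell is to DELETE the COMBINATION-SHAPED residual classes of the Birch–Swinnerton-Dyer formula for
ALL analytic-rank `≤ 1` elliptic curves over `ℚ` — "full BSD formula for every rank `≤ 1` curve in
class `C`" assembled STRICTLY from published theorems — so that the rank-`≤ 1` remainder becomes
exactly the CONSTRUCTION-SHAPED classes, which are TYPED (missing-input `Prop`s), NOT attempted.
This is not "finishing BSD". THEOREMS ONLY (no definition, no named fact, nothing about any curve is
asserted); no label of the cell moves.

## What this file does

The ± rank-zero chain of `Supersingular/SignedRankZero.lean` (p206397) displays Pollack's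
interpolation at the trivial character as a binder (P): "`L_p^ε(0) = c_ε · L(E,1)/Ω_E` with
`c_+ = 2`, `c_− = p − 1` (Kobayashi's labelling)". The tree's named fact
`pollack_exists_plusMinusPAdicLFunction` (`PlusMinusPAdicLFunction.lean`, Pollack 2003 Thm. 5.6 /
Cor. 5.11 / Prop. 6.18) produces `L⁺, L⁻ ∈ Λ` (POLLACK's labelling) through the congruences
`θ_n ≡ (-1)^{⌊n/2⌋+1} ω_n^± L^± (mod ω_n)` in `Λ ⊗ ℚ_p` with the Mazur–Tate elements `θ_n`; its
module docstring records, without proof, "`L⁻(0) = −θ₀ = 2[0]⁺`, `L⁺(0) = (p−1)[0]⁺`". This file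
PROVES those two constant-term identities in the kernel, for ANY pair `(L⁺, L⁻)` satisfying the
level-`1` resp. level-`0` congruence, for the newform `f` of a curve `W` with good reduction at an
odd `p` and `a_p = 0`:

* `algebraMap_eval_zero_eq_of_isCongrModOmega` — a congruence `θ ≡ ω·L (mod ω_n)` in `Λ ⊗ ℚ_p` gives
  `θ(0) = ω(0)·L(0)` (`ω_n(0) = 0`);
* `mazurTateElement_eval_zero` — `θ_n(0) = ∑_{a ∈ (ℤ/p^{n+e₀})ˣ} [a/p^{n+e₀}]⁺_f`;
* `sum_fin_ratPlusSymbol_eq_neg_of_ap_zero` — the `U_p`-relation at `a_p = 0`: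
  `∑_{j mod p} [(r+j)/p]⁺ = −[p r]⁺` (tree: `intCast_mul_ratPlusSymbol`, Manin–Drinfeld rationality
  `ratCast_ratPlusSymbol_holds`);
* `sum_units_ratPlusSymbol_level_one` — `∑_{a ∈ (ℤ/p)ˣ} [a/p]⁺ = −2[0]⁺`;
  `sum_units_ratPlusSymbol_level_two` — `∑_{a ∈ (ℤ/p²)ˣ} [a/p²]⁺ = −(p−1)[0]⁺`;
* `constantCoeff_pollackMinus` — `L⁻(0) = 2·[0]⁺_f`; `constantCoeff_pollackPlus` —
  `L⁺(0) = (p−1)·[0]⁺_f` (in `ℚ_p`; `[0]⁺_f = ratPlusSymbol f 0 = L(E,1)/Ω⁺_f`).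

These are Kobayashi, Invent. Math. 152 (2003), (3.6) "`L_p^+(E,0) = 2·L(E,1)/Ω_E`,
`L_p^−(E,0) = (p−1)·L(E,1)/Ω_E`" [corpus: paper:doi-10-1007-s00222-002-0265-4 p0007] in the tree's
`Ω⁺_f`-normalisation and in POLLACK's labelling (Kobayashi, p. 7: "our sign of Pollack's `p`-adic
`L`-function is opposite to that in [18]"; so Kobayashi's `L_p^+` is the tree's `L⁻` and Kobayashi's
`L_p^−` is the tree's `L⁺`). They discharge the binder (P) of the ± rank-zero chain for the real
objects (`Supersingular/KobayashiMainConjecture.lean`, this gen).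

References: [Kobayashi2003] (3.6) p. 7; [Pollack2003] Prop. 6.18, Def. 6.15;
[MazurTateTeitelbaum1986Invent] §I.4 (4.2), §I.8.
-/

set_option autoImplicit false

noncomputable section

open scoped Classical MatrixGroups ModularForm

open CongruenceSubgroup Polynomial WeierstrassCurve Literature.NumberTheory.EllipticCurves
  Literature.NumberTheory.EllipticCurves.ModularForms

namespace Summit.BirchSwinnertonDyer.Rank1Residual.Supersingular

/-! ### A congruence mod `ω_n` in `Λ ⊗ ℚ_p`, read at `T = 0` -/

section Congruence

variable {p : ℕ} [Fact p.Prime]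

omit [Fact p.Prime] in
/-- `ω_n(0) = (0+1)^{p^n} − 1 = 0`. [cite: Pollack2003, Thm. 6.17] -/
theorem eval_zero_cyclotomicOmega (n : ℕ) : (cyclotomicOmega p n).eval 0 = 0 := by
  simp [cyclotomicOmega]

/-- The constant term of (the image in `ℚ_p⟦T⟧` of) a rational polynomial is its value at `0`.
[folklore] -/
theorem constantCoeff_coe_map_eq_eval_zero (θ : ℚ[X]) :
    PowerSeries.constantCoeff ((θ.map (algebraMap ℚ ℚ_[p]) : PowerSeries ℚ_[p])) =
      algebraMap ℚ ℚ_[p] (θ.eval 0) := by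
  rw [← PowerSeries.coeff_zero_eq_constantCoeff_apply, Polynomial.coeff_coe, Polynomial.coeff_map,
    Polynomial.coeff_zero_eq_eval_zero]

/-- The constant term of `ι(ω · L)` for `ω ∈ ℤ[T]`, `L ∈ Λ`: `ω(0) · L(0)` in `ℚ_p`. [folklore] -/
theorem constantCoeff_iwasawaToPowerSeries_polynomial_mul (ω : ℤ[X]) (L : IwasawaAlgebra p) :
    PowerSeries.constantCoeff (iwasawaToPowerSeries p
        ((ω.map (Int.castRingHom ℤ_[p]) : PowerSeries ℤ_[p]) * L)) =
      ((ω.eval 0 : ℤ) : ℚ_[p]) * ((PowerSeries.constantCoeff L : ℤ_[p]) : ℚ_[p]) := by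
  rw [constantCoeff_iwasawaToPowerSeries, map_mul, ← PowerSeries.coeff_zero_eq_constantCoeff_apply,
    Polynomial.coeff_coe, Polynomial.coeff_map, Polynomial.coeff_zero_eq_eval_zero]
  push_cast
  simp

/-- **A congruence mod `ω_n` in `Λ ⊗ ℚ_p`, read at `T = 0`.** If `θ ≡ ω · L (mod ω_n)`
(`IsCongrModOmega p n θ ω L`: `p^m (θ − ω L) = ω_n q` in `ℚ_p⟦T⟧`), then `θ(0) = ω(0) · L(0)` in
`ℚ_p`, because `ω_n(0) = 0` and `p^m ≠ 0` (Pollack 2003, proof of Prop. 6.18, evaluated at the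
trivial character). [cite: Pollack2003, Prop. 6.18 (proof)] -/
theorem algebraMap_eval_zero_eq_of_isCongrModOmega {n : ℕ} {θ : ℚ[X]} {ω : ℤ[X]}
    {L : IwasawaAlgebra p} (h : IsCongrModOmega p n θ ω L) :
    algebraMap ℚ ℚ_[p] (θ.eval 0) =
      ((ω.eval 0 : ℤ) : ℚ_[p]) * ((PowerSeries.constantCoeff L : ℤ_[p]) : ℚ_[p]) := by
  obtain ⟨m, q, hmq⟩ := h
  have h0 := congrArg PowerSeries.constantCoeff hmq
  rw [map_mul, PowerSeries.constantCoeff_C, map_sub, constantCoeff_coe_map_eq_eval_zero,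
    constantCoeff_iwasawaToPowerSeries_polynomial_mul,
    constantCoeff_iwasawaToPowerSeries_polynomial_mul, eval_zero_cyclotomicOmega] at h0
  simp only [Int.cast_zero, zero_mul, mul_eq_zero] at h0
  rcases h0 with hpm | hsub
  · exact absurd hpm (pow_ne_zero _ (Nat.cast_ne_zero.mpr (Fact.out : p.Prime).ne_zero))
  · exact sub_eq_zero.mp hsub

end Congruence

/-! ### The constant term of the Mazur–Tate element `θ_n` -/

section MazurTate

variable {N : ℕ} [NeZero N] (f : CuspForm (Gamma0 N) 2) (p : ℕ) [Fact p.Prime]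

omit [NeZero N] in
/-- **`θ_n(0) = ∑_{a ∈ (ℤ/p^{n+e₀})ˣ} [a/p^{n+e₀}]⁺_f`**: at `T = 0` every `(1+T)^s` is `1`, and the
classes `η γ^s` (`η` Teichmüller, `s mod p^n`) run exactly over the units modulo `p^{n+e₀}`
(`finsum_sum_classes_eq_sum_units`) (Pollack 2003, Def. 6.15 / Remark 6.16: `θ_n` is the lift of
`∑_a [a/p^{n+1}] σ_a`). [cite: Pollack2003, Def. 6.15] -/
theorem mazurTateElement_eval_zero (n : ℕ) :
    (mazurTateElement f p n).eval 0 =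
      ∑ u : (ZMod (p ^ (n + cyclotomicExponent p)))ˣ,
        ratPlusSymbol f (((u : ZMod (p ^ (n + cyclotomicExponent p))).val : ℚ) /
          (p : ℚ) ^ (n + cyclotomicExponent p)) := by
  classical
  haveI := neZero_torsionOrder p
  haveI := Fintype.ofFinite (rootsOfUnity (torsionOrder p) ℤ_[p])
  set g : ZMod (p ^ (n + cyclotomicExponent p)) → ℚ := fun b ↦
    ratPlusSymbol f ((b.val : ℚ) / (p : ℚ) ^ (n + cyclotomicExponent p)) with hg
  have h1 : (mazurTateElement f p n).eval 0 =
      ∑ᶠ w : rootsOfUnity (torsionOrder p) ℤ_[p], ∑ s : ZMod (p ^ n),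
        g (PadicInt.toZModPow (n + cyclotomicExponent p) ((w : ℤ_[p]ˣ) : ℤ_[p]) *
          (cyclotomicGenerator p : ZMod (p ^ (n + cyclotomicExponent p))) ^ s.val) := by
    rw [mazurTateElement, finsum_eq_sum_of_fintype, finsum_eq_sum_of_fintype, eval_finsetSum]
    refine Finset.sum_congr rfl fun w _ ↦ ?_
    rw [eval_finsetSum]
    refine Finset.sum_congr rfl fun s _ ↦ ?_
    rw [eval_mul, eval_C, eval_pow, eval_add, eval_X, eval_one, zero_add, one_pow, mul_one, hg]
  rw [h1, finsum_sum_classes_eq_sum_units p n g]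

end MazurTate

/-! ### Unit sums of modular symbols at a good prime with `a_p = 0` -/

section UnitSums

variable {N : ℕ} [NeZero N] {f : CuspForm (Gamma0 N) 2} {p : ℕ} [Fact p.Prime]

/-- **The `U_p`-relation at `a_p = 0`**: `∑_{j mod p} [(r + j)/p]⁺_f = −[p r]⁺_f` for a rational
newform `f` of level prime to `p` with `a_p(f) = 0` (Mazur–Tate–Teitelbaum 1986, §I.4 (4.2):
`a_p [r]⁺ = ∑_j [(r+j)/p]⁺ + [p r]⁺`; tree `intCast_mul_ratPlusSymbol` with Manin–Drinfeld
rationality `ratCast_ratPlusSymbol_holds`). [cite: MazurTateTeitelbaum1986Invent, §I.4 (4.2)] -/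
theorem sum_fin_ratPlusSymbol_eq_neg_of_ap_zero (hf : IsNewform0 f) (hQ : coeffField f = ⊥)
    (hpN : ¬ p ∣ N) (hap : cuspCoeff f p = 0) (r : ℚ) :
    ∑ j : Fin p, ratPlusSymbol f ((r + j) / p) = - ratPlusSymbol f (p * r) := by
  have hrat : ∀ r : ℚ, (ratPlusSymbol f r : ℝ) = normalizedPlusSymbol f r :=
    fun r ↦ ratCast_ratPlusSymbol_holds hf hQ r
  have h := intCast_mul_ratPlusSymbol p hf (Fact.out : p.Prime) hpN (ap := 0)
    (by rw [hap, Int.cast_zero]) hrat r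
  rw [Int.cast_zero, zero_mul] at h
  linarith

/-- Auxiliary: the sum over a fibre of `ℤ/p^{n+1} → ℤ/p^n` of `[b/p^{n+1}]⁺` at `a_p = 0` is
`−[a/p^{n−1}]⁺` in the form `−[p · (a/p^n)]⁺`: the fibre is `{a + p^n j}_{j<p}`
(`filter_castHom_eq_image`) and `(a + p^n j)/p^{n+1} = (a/p^n + j)/p`.
[cite: MazurTateTeitelbaum1986Invent, §I.10 Prop. (10.2)] -/
theorem sum_fiber_ratPlusSymbol_eq_neg_of_ap_zero (hf : IsNewform0 f) (hQ : coeffField f = ⊥)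
    (hpN : ¬ p ∣ N) (hap : cuspCoeff f p = 0) (n : ℕ) (a : ZMod (p ^ n)) :
    ∑ b ∈ Finset.univ.filter (fun b : ZMod (p ^ (n + 1)) ↦
        ZMod.castHom (pow_dvd_pow p n.le_succ) (ZMod (p ^ n)) b = a),
      ratPlusSymbol f ((b.val : ℚ) / (p : ℚ) ^ (n + 1)) =
      - ratPlusSymbol f ((p : ℚ) * ((a.val : ℚ) / (p : ℚ) ^ n)) := by
  classical
  haveI : NeZero p := ⟨(Fact.out : p.Prime).ne_zero⟩
  have hp : p.Prime := Fact.out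
  have hp0 : (p : ℚ) ≠ 0 := by exact_mod_cast hp.ne_zero
  have hinj : Function.Injective
      (fun j : Fin p ↦ ((a.val + p ^ n * (j : ℕ) : ℕ) : ZMod (p ^ (n + 1)))) := by
    intro j j' h
    have hv := congr_arg ZMod.val h
    simp only [val_classLift] at hv
    exact Fin.ext (Nat.eq_of_mul_eq_mul_left (pow_pos hp.pos n) (by omega))
  rw [filter_castHom_eq_image, Finset.sum_image fun j _ j' _ h ↦ hinj h,
    ← sum_fin_ratPlusSymbol_eq_neg_of_ap_zero hf hQ hpN hap]
  refine Finset.sum_congr rfl fun j _ ↦ ?_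
  rw [val_classLift]
  congr 1
  push_cast
  field_simp
  ring

/-- **`∑_{a ∈ (ℤ/p)ˣ} [a/p]⁺_f = −2·[0]⁺_f`** at a good prime with `a_p = 0`: by the `U_p`-relation
at `r = 0`, `∑_{a mod p} [a/p]⁺ = −[0]⁺`, and the class `a = 0` contributes `[0]⁺`. (Level written
`p^L` with `L = 0 + 1`, so that the lemma applies at level `p^{0+e₀}` for odd `p` without rewriting
inside `ZMod`.) [cite: MazurTateTeitelbaum1986Invent, §I.4 (4.2)] -/
theorem sum_units_ratPlusSymbol_level_one (hf : IsNewform0 f) (hQ : coeffField f = ⊥)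
    (hpN : ¬ p ∣ N) (hap : cuspCoeff f p = 0) (L : ℕ) (hL : L = 0 + 1) :
    ∑ u : (ZMod (p ^ L))ˣ, ratPlusSymbol f (((u : ZMod (p ^ L)).val : ℚ) / (p : ℚ) ^ L) =
      -2 * ratPlusSymbol f 0 := by
  classical
  subst hL
  haveI : NeZero (p ^ (0 + 1)) := ⟨pow_ne_zero _ (Fact.out : p.Prime).ne_zero⟩
  -- the whole level-`p` sum is the fibre over the unique class modulo `p^0`
  have hall : ∑ b : ZMod (p ^ (0 + 1)), ratPlusSymbol f ((b.val : ℚ) / (p : ℚ) ^ (0 + 1)) =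
      - ratPlusSymbol f 0 := by
    haveI : Subsingleton (ZMod (p ^ 0)) := (ZMod.subsingleton_iff).mpr (pow_zero p)
    have hfil : Finset.univ.filter (fun b : ZMod (p ^ (0 + 1)) ↦
        ZMod.castHom (pow_dvd_pow p (Nat.le_succ 0)) (ZMod (p ^ 0)) b = 0) = Finset.univ :=
      Finset.filter_true_of_mem fun b _ ↦ Subsingleton.elim _ _
    have h := sum_fiber_ratPlusSymbol_eq_neg_of_ap_zero hf hQ hpN hap 0 (0 : ZMod (p ^ 0))
    rw [hfil] at h
    rw [h, ZMod.val_zero, Nat.cast_zero, zero_div, mul_zero]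
  -- units = non-zero classes
  rw [sum_units_eq_sum_filter_isUnit (F := fun b : ZMod (p ^ (0 + 1)) ↦
      ratPlusSymbol f ((b.val : ℚ) / (p : ℚ) ^ (0 + 1)))]
  have hfil : Finset.univ.filter (fun a : ZMod (p ^ (0 + 1)) ↦ IsUnit a) = Finset.univ.erase 0 := by
    ext a
    simp [isUnit_iff_ne_zero_level_one]
  rw [hfil, Finset.sum_erase_eq_sub (Finset.mem_univ _), hall, ZMod.val_zero, Nat.cast_zero,
    zero_div]
  ring

/-- **`∑_{a ∈ (ℤ/p²)ˣ} [a/p²]⁺_f = −(p−1)·[0]⁺_f`** at a good prime with `a_p = 0`: group the units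
modulo `p²` by their residue `a` modulo `p` (a unit); each fibre gives `−[a]⁺ = −[0]⁺`
(`[r + n]⁺ = [r]⁺`), and there are `p − 1` units modulo `p`. (Level written `p^L`, `L = 1 + 1`.)
[cite: MazurTateTeitelbaum1986Invent, §I.4 (4.2)] -/
theorem sum_units_ratPlusSymbol_level_two (hf : IsNewform0 f) (hQ : coeffField f = ⊥)
    (hpN : ¬ p ∣ N) (hap : cuspCoeff f p = 0) (L : ℕ) (hL : L = 1 + 1) :
    ∑ u : (ZMod (p ^ L))ˣ, ratPlusSymbol f (((u : ZMod (p ^ L)).val : ℚ) / (p : ℚ) ^ L) =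
      -((p : ℚ) - 1) * ratPlusSymbol f 0 := by
  classical
  subst hL
  have hp : p.Prime := Fact.out
  haveI : NeZero (p ^ (1 + 1)) := ⟨pow_ne_zero _ hp.ne_zero⟩
  haveI : NeZero (p ^ 1) := ⟨pow_ne_zero _ hp.ne_zero⟩
  have hp0 : (p : ℚ) ≠ 0 := by exact_mod_cast hp.ne_zero
  set F : ZMod (p ^ (1 + 1)) → ℚ := fun b ↦
    ratPlusSymbol f ((b.val : ℚ) / (p : ℚ) ^ (1 + 1)) with hF
  set π := ZMod.castHom (pow_dvd_pow p (Nat.le_succ 1)) (ZMod (p ^ 1)) with hπ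
  rw [sum_units_eq_sum_filter_isUnit (F := F), Finset.sum_filter,
    ← Finset.sum_fiberwise Finset.univ π
      (fun b : ZMod (p ^ (1 + 1)) ↦ if IsUnit b then F b else 0)]
  -- each fibre over a unit `a mod p` contributes `−[0]⁺`, the others `0`
  have hfib : ∀ a : ZMod (p ^ 1),
      ∑ b ∈ Finset.univ.filter (fun b : ZMod (p ^ (1 + 1)) ↦ π b = a),
        (if IsUnit b then F b else 0) = if IsUnit a then - ratPlusSymbol f 0 else 0 := by
    intro a
    -- on the fibre over `a`, `b` is a unit iff `a` is
    have hiff : ∀ b ∈ Finset.univ.filter (fun b : ZMod (p ^ (1 + 1)) ↦ π b = a),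
        IsUnit b ↔ IsUnit a := by
      intro b hb
      have hba : π b = a := (Finset.mem_filter.mp hb).2
      rw [isUnit_iff_isUnit_castHom (p := p) le_rfl (Nat.le_succ 1) b, ← hπ, hba]
    by_cases ha : IsUnit a
    · rw [if_pos ha, Finset.sum_congr rfl fun b hb ↦ if_pos ((hiff b hb).mpr ha), hπ,
        sum_fiber_ratPlusSymbol_eq_neg_of_ap_zero hf hQ hpN hap 1 a]
      have harg : (p : ℚ) * ((a.val : ℚ) / (p : ℚ) ^ 1) = ((0 : ℚ) + ((a.val : ℤ) : ℚ)) := by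
        rw [pow_one (p : ℚ), mul_div_cancel₀ _ hp0]
        push_cast
        ring
      rw [harg, ratPlusSymbol_add_intCast_eq]
    · rw [if_neg ha]
      exact Finset.sum_eq_zero fun b hb ↦ if_neg (fun hb' ↦ ha ((hiff b hb).mp hb'))
  simp only [hfib]
  rw [← Finset.sum_filter, Finset.sum_const, nsmul_eq_mul]
  -- `#(ℤ/p)ˣ = p − 1`
  have hcard : (Finset.univ.filter (fun a : ZMod (p ^ 1) ↦ IsUnit a)).card = p - 1 := by
    have hfil : Finset.univ.filter (fun a : ZMod (p ^ 1) ↦ IsUnit a) = Finset.univ.erase 0 := by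
      ext a
      simp [isUnit_iff_ne_zero_level_one]
    rw [hfil, Finset.card_erase_of_mem (Finset.mem_univ _), Finset.card_univ, ZMod.card, pow_one]
  rw [hcard]
  have h1 : 1 ≤ p := hp.one_lt.le
  push_cast [Nat.cast_sub h1]
  ring

end UnitSums

/-! ### The constant terms of `L⁺` and `L⁻` -/

section Pollack

variable {W : WeierstrassCurve ℚ} [W.IsElliptic] [W.IsGloballyMinimal] {N : ℕ} [NeZero N]
  {f : CuspForm (Gamma0 N) 2} {p : ℕ} [Fact p.Prime]

omit [W.IsElliptic] [W.IsGloballyMinimal] [NeZero N] [Fact p.Prime] in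
/-- For odd `p`, `0 + e₀ = 0 + 1` (`e₀ = cyclotomicExponent p = 1`). [folklore] -/
theorem zero_add_cyclotomicExponent_eq (hp : p ≠ 2) : 0 + cyclotomicExponent p = 0 + 1 := by
  unfold cyclotomicExponent
  rw [if_neg hp]

omit [W.IsElliptic] [W.IsGloballyMinimal] [NeZero N] [Fact p.Prime] in
/-- For odd `p`, `1 + e₀ = 1 + 1`. [folklore] -/
theorem one_add_cyclotomicExponent_eq (hp : p ≠ 2) : 1 + cyclotomicExponent p = 1 + 1 := by
  unfold cyclotomicExponent
  rw [if_neg hp]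

/-- `a_p(f) = 0` for the newform of a curve with good reduction at `p` and `a_p = 0`. [folklore] -/
theorem cuspCoeff_eq_zero_of_frobeniusTrace_eq_zero (hf : IsNewformOf W f)
    (hgood : W.HasGoodReductionAtPrime p) (hap : W.frobeniusTrace p = 0) : cuspCoeff f p = 0 := by
  rw [cuspCoeff_eq_frobeniusTrace_of_isNewformOf_holds hf hgood, hap, Int.cast_zero]

/-- **`L⁻(0) = 2 · [0]⁺_f`** (Pollack's labelling; = Kobayashi's `L_p^+(E,0) = 2·L(E,1)/Ω_E`,
Invent. Math. 152 (2003) (3.6), in the `Ω⁺_f`-normalisation). For the newform `f` of `W`, an odd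
good prime `p` with `a_p = 0`, and ANY `L⁻ ∈ Λ` satisfying the level-`0` Mazur–Tate congruence of
`pollack_exists_plusMinusPAdicLFunction` (`θ₀ ≡ (−1)^{0+1} ω₀⁻ L⁻ (mod ω₀)`): `θ₀(0) = −L⁻(0)` and
`θ₀(0) = ∑_{a ∈ (ℤ/p)ˣ} [a/p]⁺ = −2[0]⁺`. [cite: Kobayashi2003, (3.6) (p. 7)] [cite: Pollack2003, Prop. 6.18] -/
theorem constantCoeff_pollackMinus (hp : p ≠ 2) (hf : IsNewformOf W f)
    (hgood : W.HasGoodReductionAtPrime p) (hap : W.frobeniusTrace p = 0) {Lminus : IwasawaAlgebra p}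
    (h0 : IsCongrModOmega p 0 (mazurTateElement f p 0)
      ((-1) ^ (0 / 2 + 1) * cyclotomicOmegaMinus p 0) Lminus) :
    ((PowerSeries.constantCoeff Lminus : ℤ_[p]) : ℚ_[p]) = ((2 * ratPlusSymbol f 0 : ℚ) : ℚ_[p]) := by
  have h := algebraMap_eval_zero_eq_of_isCongrModOmega h0
  rw [mazurTateElement_eval_zero,
    sum_units_ratPlusSymbol_level_one hf.1 hf.coeffField_eq_bot (not_dvd_level_of_isNewformOf hf hgood)
      (cuspCoeff_eq_zero_of_frobeniusTrace_eq_zero hf hgood hap) _ (zero_add_cyclotomicExponent_eq hp)]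
    at h
  simp only [cyclotomicOmegaMinus_zero, mul_one, eval_pow, eval_neg, eval_one] at h
  norm_num at h
  push_cast
  linear_combination -h

/-- **`L⁺(0) = (p − 1) · [0]⁺_f`** (Pollack's labelling; = Kobayashi's
`L_p^−(E,0) = (p−1)·L(E,1)/Ω_E`, (3.6)). For ANY `L⁺ ∈ Λ` satisfying the level-`1` congruence
`θ₁ ≡ (−1)^{0+1} ω₁⁺ L⁺ (mod ω₁)` (`ω₁⁺ = 1`): `θ₁(0) = −L⁺(0)` and
`θ₁(0) = ∑_{a ∈ (ℤ/p²)ˣ} [a/p²]⁺ = −(p−1)[0]⁺`. [cite: Kobayashi2003, (3.6) (p. 7)] [cite: Pollack2003, Prop. 6.18] -/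
theorem constantCoeff_pollackPlus (hp : p ≠ 2) (hf : IsNewformOf W f)
    (hgood : W.HasGoodReductionAtPrime p) (hap : W.frobeniusTrace p = 0) {Lplus : IwasawaAlgebra p}
    (h1 : IsCongrModOmega p 1 (mazurTateElement f p 1)
      ((-1) ^ (1 / 2 + 1) * cyclotomicOmegaPlus p 1) Lplus) :
    ((PowerSeries.constantCoeff Lplus : ℤ_[p]) : ℚ_[p]) =
      ((((p : ℚ) - 1) * ratPlusSymbol f 0 : ℚ) : ℚ_[p]) := by
  have hω : cyclotomicOmegaPlus p 1 = 1 := by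
    unfold cyclotomicOmegaPlus
    rw [show (1 : ℕ) / 2 = 0 from rfl, Finset.Icc_eq_empty (by omega), Finset.prod_empty]
  have h := algebraMap_eval_zero_eq_of_isCongrModOmega h1
  rw [mazurTateElement_eval_zero,
    sum_units_ratPlusSymbol_level_two hf.1 hf.coeffField_eq_bot (not_dvd_level_of_isNewformOf hf hgood)
      (cuspCoeff_eq_zero_of_frobeniusTrace_eq_zero hf hgood hap) _ (one_add_cyclotomicExponent_eq hp)]
    at h
  simp only [hω, mul_one, eval_pow, eval_neg, eval_one] at h
  norm_num at h
  push_cast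
  linear_combination h

end Pollack

end Summit.BirchSwinnertonDyer.Rank1Residual.Supersingular

end
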